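import Literature.NumberTheory.QuadraticFields.RedeiReichardtPrincipalAmbiguous
import Literature.NumberTheory.QuadraticFields.RedeiReichardtGroupLemmas
import Literature.NumberTheory.QuadraticFields.GenusCharactersExhaust
import Mathlib.NumberTheory.LegendreSymbol.JacobiSymbol
import HarnessLib

/-!
# Genus characters on the ramified prime classes of `ℚ(√-n)` and the square criterion

Topic `NumberTheory/QuadraticFields`, namespace `Literature.NumberTheory.QuadraticFields.RedeiReichardt`
(towards `redeiReichardt_fourTwoCard_classGroup`, Li–Ma 2008 Thm. 0.4 / Stevenhagen 1995 §2 Thm. 1).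
Theorem-only file (no definition, no named fact).

For `K ∋ √-n` imaginary quadratic, prime tuple `p₁, …, p_t` of `disc K` and ramified primes `𝔭ᵢ`
(`𝔭ᵢ² = (pᵢ)`), and Gauss's genus characters `ψ_q` (`q` an odd prime of `disc K`; the tree's
`genusChar`, `ψ_q([𝔞]) = (N𝔞/q)`):

* `genusChar_mk0_eq_jacobiSym` — `ψ_{pᵢ}([𝔭ⱼ]) = (pⱼ / pᵢ)` for `j ≠ i`;
* `prod_mk0_eq_one`, `genusChar_mk0_self_eq_jacobiSym` — `∏_{pⱼ ∣ n} [𝔭ⱼ] = 1` (as `(√-n) = ∏ 𝔭ⱼ`),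
  hence `ψ_{pᵢ}([𝔭ᵢ]) = ((n/pᵢ) / pᵢ)`;
* `isSquare_iff_forall_genusChar_eq_one` — **a class is a square iff all `ψ_q` vanish on it** (the
  real characters of `Cl_K` are the products of the `ψ_q`, tree `exists_genusCharProd_eq`, and `Cl²`
  is the common kernel of the real characters);
* `isSquare_prod_iff` — for `e ∈ 𝔽₂^t`: `∏ [𝔭ⱼ]^{eⱼ} ∈ Cl_K²` iff for every odd `pᵢ`,
  `Σⱼ Mᵢⱼ eⱼ = 0` in `𝔽₂`, where `Mᵢⱼ = [(pⱼ/pᵢ) = -1]` (`j ≠ i`), `Mᵢᵢ = [((n/pᵢ)/pᵢ) = -1]` —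
  Stevenhagen's matrix of character values (the transpose of Li–Ma's `RM(D)`, see the sequel).

## References

* P. Stevenhagen, *Rédei-matrices and applications*, LMS LNS 215 (1995), §2 Thm. 1 and its proof.
  [Stevenhagen1995RedeiMatrices]
* Y. Li, L. Ma, Acta Arith. 134 (2008), Def. 0.2, Thm. 0.4. [LiMa2008]
* D. A. Cox, *Primes of the form x² + ny²*, 2nd ed. (2013), §3.B Thm. 3.15 (genus characters). [Cox2013]
-/

noncomputable section

open NumberField Ideal Module
open scoped nonZeroDivisors

namespace Literature.NumberTheory.QuadraticFields.RedeiReichardt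

open Literature.NumberTheory.QuadraticFields.Quadratic Literature.NumberTheory.EllipticCurves

/-! ### A sign lemma -/

/-- For signs `sⱼ ∈ {±1}` and exponents `eⱼ ∈ 𝔽₂`: `∏ sⱼ^{eⱼ} = 1` iff `Σⱼ [sⱼ = -1]·eⱼ = 0` in `𝔽₂`.
[folklore] -/
private theorem prod_pow_eq_one_iff {ι : Type*} [Fintype ι] {s : ι → ℤ} (hs : ∀ j, s j = 1 ∨ s j = -1)
    (e : ι → ZMod 2) :
    ∏ j, s j ^ (e j).val = 1 ↔ ∑ j, (if s j = -1 then (1 : ZMod 2) else 0) * e j = 0 := by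
  classical
  have hsj : ∀ j, s j ^ (e j).val = (-1 : ℤ) ^ (if s j = -1 then (e j).val else 0) := fun j => by
    rcases hs j with h | h
    · rw [h, one_pow, if_neg (by norm_num), pow_zero]
    · rw [h, if_pos rfl]
  rw [Finset.prod_congr rfl fun j _ => hsj j, Finset.prod_pow_eq_pow_sum,
    neg_one_pow_eq_one_iff_even (by norm_num), ← ZMod.natCast_eq_zero_iff_even, Nat.cast_sum]
  have hterm : ∀ j, ((if s j = -1 then (e j).val else 0 : ℕ) : ZMod 2) =
      (if s j = -1 then (1 : ZMod 2) else 0) * e j := fun j => by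
    by_cases h : s j = -1
    · rw [if_pos h, if_pos h, one_mul, ZMod.natCast_zmod_val]
    · rw [if_neg h, if_neg h, zero_mul, Nat.cast_zero]
  rw [Finset.sum_congr rfl fun j _ => hterm j]

/-- Multiplicativity of the Jacobi symbol in the numerator, over a `Finset`. [folklore] -/
private theorem prod_jacobiSym_eq {ι : Type*} (s : Finset ι) (f : ι → ℤ) (b : ℕ) :
    ∏ j ∈ s, jacobiSym (f j) b = jacobiSym (∏ j ∈ s, f j) b := by
  classical
  induction s using Finset.induction_on with
  | empty => simp [jacobiSym.one_left]
  | insert a s ha ih => rw [Finset.prod_insert ha, Finset.prod_insert ha, jacobiSym.mul_left, ih]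

/-! ### The setting -/

section Setup

variable {K : Type*} [Field K] [NumberField K] (h2 : finrank ℚ K = 2)
  {n : ℕ} {x : 𝓞 K} (hx : x ^ 2 = -(n : 𝓞 K))
  {t : ℕ} {p : Fin t → ℕ} (hp : ∀ i, (p i).Prime) (hinj : Function.Injective p)
  (hprod : ∏ i, p i = if n % 4 = 1 then 2 * n else n)
  {P : Fin t → Ideal (𝓞 K)} (hP : ∀ i, P i ^ 2 = span {(p i : 𝓞 K)})

omit [NumberField K] in
include hx in
/-- `x² = -n` read in `K`. [folklore] -/
private theorem coe_sq_eq' : ((x : 𝓞 K) : K) ^ 2 = -(n : K) := by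
  have h := congrArg (fun y : 𝓞 K => (y : K)) hx
  simpa using h

include h2 hx hp hinj hprod in
/-- Every prime of the tuple divides `disc K` (`= -n` or `-4n`). [cite: LiMa2008, Lemma 0.1] -/
theorem natCast_dvd_discr (i : Fin t) : ((p i : ℕ) : ℤ) ∣ NumberField.discr K := by
  obtain ⟨hn, hn0⟩ := squarefree_and_pos_of_prod_eq hp hinj hprod
  rw [discr_eq h2 hn (coe_sq_eq' hx)]
  rcases dvd_or_of_prod_eq hp hprod i with h | ⟨h2i, h4⟩
  · split_ifs
    · exact (Int.natCast_dvd_natCast.mpr h).neg_right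
    · exact (Dvd.dvd.mul_left (Int.natCast_dvd_natCast.mpr h) (-4))
  · rw [if_neg (by omega), h2i]
    exact ⟨-2 * n, by ring⟩

include hp hinj hprod in
/-- `∏_{pⱼ ∣ n} pⱼ = n`: the primes of the tuple dividing `n` are exactly the prime factors of the
square-free `n`. [cite: LiMa2008, Lemma 0.1] -/
theorem prod_filter_dvd_eq : ∏ j ∈ Finset.univ.filter (fun j => p j ∣ n), p j = n := by
  classical
  obtain ⟨hn, hn0⟩ := squarefree_and_pos_of_prod_eq hp hinj hprod
  refine Eq.trans ?_ (Nat.prod_primeFactors_of_squarefree hn)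
  refine Finset.prod_nbij (fun j => p j) (fun j hj => ?_) (fun j _ k _ h => hinj h) (fun q hq => ?_)
    (fun j _ => rfl)
  · exact Nat.mem_primeFactors.mpr ⟨hp j, (Finset.mem_filter.mp hj).2, hn0.ne'⟩
  · obtain ⟨hq, hqn, -⟩ := Nat.mem_primeFactors.mp (Finset.mem_coe.mp hq)
    obtain ⟨j, rfl⟩ := exists_eq_of_prime_dvd hp hprod hq hqn
    exact ⟨j, Finset.mem_coe.mpr (Finset.mem_filter.mpr ⟨Finset.mem_univ j, hqn⟩), rfl⟩

/-! ### Values of the genus characters on the ramified primes -/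

include h2 hx hp hinj hprod hP in
/-- **`ψ_{pᵢ}([𝔭ⱼ]) = (pⱼ / pᵢ)`** for `j ≠ i` and `pᵢ` odd (`N𝔭ⱼ = pⱼ` is prime to `pᵢ`).
[cite: Stevenhagen1995RedeiMatrices, §2 (the matrix entries `χᵢ(pⱼ)`)] [cite: Cox2013, §3.B Thm. 3.15] -/
theorem genusChar_mk0_eq_jacobiSym {i j : Fin t} (hi2 : p i ≠ 2) (hij : i ≠ j) :
    ((@genusChar K _ _ (isImaginaryQuadratic h2 (squarefree_and_pos_of_prod_eq hp hinj hprod).1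
        (coe_sq_eq' hx)) (p i) ⟨hp i⟩ hi2 (natCast_dvd_discr h2 hx hp hinj hprod i)
        (ClassGroup.mk0 ⟨P j, mem_nonZeroDivisors_of_sq_eq_span h2 (hp j) (hP j)⟩) : ℂˣ) : ℂ) =
      (jacobiSym (p j) (p i) : ℂ) := by
  haveI : Fact (p i).Prime := ⟨hp i⟩
  have hnorm : absNorm (P j) = p j := absNorm_eq_of_sq_eq_span h2 (hP j)
  have hndvd : ¬ ((p i : ℕ) : ℤ) ∣ (absNorm (P j) : ℤ) := by
    rw [hnorm, Int.natCast_dvd_natCast, Nat.prime_dvd_prime_iff_eq (hp i) (hp j)]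
    exact fun h => hij (hinj h)
  rw [genusChar_mk0_eq _ hi2 _ _ hndvd, hnorm, jacobiSym.legendreSym.to_jacobiSym]

include h2 hx hp hinj hprod hP in
/-- **`∏_{pⱼ ∣ n} [𝔭ⱼ] = 1`**: for `pⱼ ∣ n` the ramified prime is `𝔭ⱼ = (pⱼ, √-n)`, and
`∏_{p ∣ n} (p, √-n) = (√-n)` is principal. [cite: Stevenhagen1995RedeiMatrices, §2] -/
theorem prod_mk0_eq_one :
    ∏ j ∈ Finset.univ.filter (fun j => p j ∣ n),
      ClassGroup.mk0 ⟨P j, mem_nonZeroDivisors_of_sq_eq_span h2 (hp j) (hP j)⟩ = 1 := by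
  classical
  obtain ⟨hn, hn0⟩ := squarefree_and_pos_of_prod_eq hp hinj hprod
  -- `𝔭ⱼ = (pⱼ, x)` for `pⱼ ∣ n`
  have hPj : ∀ j, p j ∣ n → P j = span {(p j : 𝓞 K), x} := fun j hj => by
    haveI := isMaximal_of_sq_eq_span h2 (hp j) (sq_span_pair_eq_span hn hx (hp j) hj)
    exact (eq_of_sq_eq_span_of_mem h2 (hp j) (sq_span_pair_eq_span hn hx (hp j) hj)
      (isMaximal_of_sq_eq_span h2 (hp j) (hP j)).isPrime' (natCast_mem hP j))
  -- the underlying ideal of the product is `∏_{q ∣ n} (q, x) = (x)`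
  rw [← map_prod, ClassGroup.mk0_eq_one_iff]
  have hcoe : ((∏ j ∈ Finset.univ.filter (fun j => p j ∣ n),
      (⟨P j, mem_nonZeroDivisors_of_sq_eq_span h2 (hp j) (hP j)⟩ : (Ideal (𝓞 K))⁰) : (Ideal (𝓞 K))⁰) :
        Ideal (𝓞 K)) = span {x} := by
    rw [Submonoid.coe_finsetProd]
    simp only []
    rw [← prod_span_pair_eq_span hn hx h2]
    -- reindex `{j : pⱼ ∣ n} ≃ n.primeFactors` by `j ↦ pⱼ`
    rw [Finset.prod_congr rfl fun j hj => hPj j (Finset.mem_filter.mp hj).2]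
    refine Finset.prod_nbij (fun j => p j) (fun j hj => ?_) (fun j _ k _ h => hinj h) (fun q hq => ?_)
      (fun j _ => rfl)
    · have hj' := (Finset.mem_filter.mp hj).2
      exact Nat.mem_primeFactors.mpr ⟨hp j, hj', hn0.ne'⟩
    · obtain ⟨hq, hqn, -⟩ := Nat.mem_primeFactors.mp (Finset.mem_coe.mp hq)
      obtain ⟨j, rfl⟩ := exists_eq_of_prime_dvd hp hprod hq hqn
      exact ⟨j, Finset.mem_coe.mpr (Finset.mem_filter.mpr ⟨Finset.mem_univ j, hqn⟩), rfl⟩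
  rw [hcoe]
  exact ⟨⟨x, rfl⟩⟩

include h2 hx hp hinj hprod hP in
/-- **`ψ_{pᵢ}([𝔭ᵢ]) = ((n/pᵢ) / pᵢ)`** for `pᵢ` odd: `[𝔭ᵢ] = ∏_{pⱼ ∣ n, j ≠ i} [𝔭ⱼ]` by
`prod_mk0_eq_one` (`pᵢ ∣ n` as `pᵢ` is odd), and `ψ_{pᵢ}([𝔭ⱼ]) = (pⱼ/pᵢ)`.
[cite: Stevenhagen1995RedeiMatrices, §2 (the diagonal entries of the Rédei matrix)] -/
theorem genusChar_mk0_self_eq_jacobiSym {i : Fin t} (hi2 : p i ≠ 2) :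
    ((@genusChar K _ _ (isImaginaryQuadratic h2 (squarefree_and_pos_of_prod_eq hp hinj hprod).1
        (coe_sq_eq' hx)) (p i) ⟨hp i⟩ hi2 (natCast_dvd_discr h2 hx hp hinj hprod i)
        (ClassGroup.mk0 ⟨P i, mem_nonZeroDivisors_of_sq_eq_span h2 (hp i) (hP i)⟩) : ℂˣ) : ℂ) =
      (jacobiSym ((n / p i : ℕ) : ℤ) (p i) : ℂ) := by
  classical
  haveI : Fact (p i).Prime := ⟨hp i⟩
  obtain ⟨hn, hn0⟩ := squarefree_and_pos_of_prod_eq hp hinj hprod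
  have hin : p i ∣ n := by
    rcases dvd_or_of_prod_eq hp hprod i with h | ⟨h2i, -⟩
    · exact h
    · exact absurd h2i hi2
  set hK := isImaginaryQuadratic h2 hn (coe_sq_eq' hx) with hKdef
  set ψ := @genusChar K _ _ hK (p i) ⟨hp i⟩ hi2 (natCast_dvd_discr h2 hx hp hinj hprod i) with hψ
  set c : Fin t → ClassGroup (𝓞 K) := fun j =>
    ClassGroup.mk0 ⟨P j, mem_nonZeroDivisors_of_sq_eq_span h2 (hp j) (hP j)⟩ with hc
  -- `c i = ∏_{j ≠ i, pⱼ ∣ n} c j`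
  have hrel := prod_mk0_eq_one h2 hx hp hinj hprod hP
  have hmem : i ∈ Finset.univ.filter (fun j => p j ∣ n) := Finset.mem_filter.mpr ⟨Finset.mem_univ i, hin⟩
  rw [← Finset.mul_prod_erase _ _ hmem] at hrel
  have hci2 : c i ^ 2 = 1 := mk0_sq_eq_one_of_sq_eq_span (hp i) (hP i) _
  have hci : c i = ∏ j ∈ (Finset.univ.filter (fun j => p j ∣ n)).erase i, c j := by
    have h1 : c i * (c i * ∏ j ∈ (Finset.univ.filter (fun j => p j ∣ n)).erase i, c j) = c i * 1 := by
      rw [hrel]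
    rw [← mul_assoc, ← sq, hci2, one_mul, mul_one] at h1
    exact h1.symm
  -- apply `ψ`
  change ((ψ (c i) : ℂˣ) : ℂ) = _
  rw [hci, map_prod, Units.coe_prod]
  rw [Finset.prod_congr rfl fun j hj => by
    exact genusChar_mk0_eq_jacobiSym h2 hx hp hinj hprod hP hi2 (Finset.ne_of_mem_erase hj).symm]
  -- `∏_{j ≠ i, pⱼ ∣ n} (pⱼ / pᵢ) = ((∏ pⱼ) / pᵢ) = ((n / pᵢ) / pᵢ)`
  rw [← Int.cast_prod, prod_jacobiSym_eq]
  congr 2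
  have hprodn := prod_filter_dvd_eq hp hinj hprod
  rw [← Finset.mul_prod_erase _ _ hmem] at hprodn
  have hdiv : ∏ j ∈ (Finset.univ.filter (fun j => p j ∣ n)).erase i, p j = n / p i :=
    (Nat.div_eq_of_eq_mul_left (hp i).pos (by rw [mul_comm]; exact hprodn.symm)).symm
  rw [← hdiv]
  push_cast
  rfl

/-! ### The square criterion -/

include h2 hx hp hinj hprod in
/-- **A class of `Cl_K` is a square iff every genus character `ψ_{pᵢ}` (`pᵢ` odd) is trivial on
it**: the real characters of `Cl_K` are exactly the products of the `ψ_q` (tree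
`exists_genusCharProd_eq`), and `Cl_K²` is the common kernel of the real characters
(`isSquare_iff_forall_character_sq_eq_one`).
[cite: Stevenhagen1995RedeiMatrices, §2 (proof of Thm. 1)] [cite: Cox2013, §3.B Thm. 3.15] -/
theorem isSquare_iff_forall_genusChar_eq_one (c : ClassGroup (𝓞 K)) :
    IsSquare c ↔ ∀ (i : Fin t) (hi2 : p i ≠ 2),
      @genusChar K _ _ (isImaginaryQuadratic h2 (squarefree_and_pos_of_prod_eq hp hinj hprod).1
        (coe_sq_eq' hx)) (p i) ⟨hp i⟩ hi2 (natCast_dvd_discr h2 hx hp hinj hprod i) c = 1 := by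
  classical
  obtain ⟨hn, hn0⟩ := squarefree_and_pos_of_prod_eq hp hinj hprod
  set hK := isImaginaryQuadratic h2 hn (coe_sq_eq' hx) with hKdef
  constructor
  · rintro ⟨d, rfl⟩ i hi2
    rw [map_mul, ← MonoidHom.mul_apply, genusChar_mul_self, MonoidHom.one_apply]
  · intro h
    rw [isSquare_iff_forall_character_sq_eq_one]
    intro χ hχ
    obtain ⟨S, hS, rfl⟩ := exists_genusCharProd_eq hK χ hχ
    apply Units.val_injective
    rw [coe_genusCharProd_apply, Units.val_one]
    refine Finset.prod_eq_one fun q _ => ?_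
    obtain ⟨hq, hq2, hqd⟩ := mem_P₀ (hS q.2)
    -- `q` is an odd prime of `disc K = -n` or `-4n`, hence of `n`, hence some `pᵢ`
    have hqn : (q : ℕ) ∣ n := by
      rw [discr_eq h2 hn (coe_sq_eq' hx)] at hqd
      split_ifs at hqd
      · exact Int.natCast_dvd_natCast.mp (Int.dvd_neg.mp hqd)
      · have h4 : ((q : ℕ) : ℤ) ∣ 4 * n := by
          have := Int.dvd_neg.mpr hqd
          simpa using this
        have h4' : (q : ℕ) ∣ 4 * n := by exact_mod_cast h4
        rcases (Nat.Prime.dvd_mul hq).mp h4' with h | h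
        · exfalso
          have : (q : ℕ) ∣ 2 := by
            have h22 : (q : ℕ) ∣ 2 * 2 := by simpa using h
            rcases (Nat.Prime.dvd_mul hq).mp h22 with h' | h' <;> exact h'
          exact hq2 ((Nat.prime_dvd_prime_iff_eq hq Nat.prime_two).mp this)
        · exact h
    obtain ⟨i, hi⟩ := exists_eq_of_prime_dvd hp hprod hq hqn
    have aux : ∀ (q' : ℕ) (hq'2 : q' ≠ 2) (hq'd : ((q' : ℕ) : ℤ) ∣ NumberField.discr K) (j : Fin t),
        p j = q' → ∀ [hF : Fact q'.Prime], @genusChar K _ _ hK q' hF hq'2 hq'd c = 1 := by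
      rintro q' hq'2 hq'd j rfl _
      exact h j hq'2
    rw [aux q.1 hq2 hqd i hi (hF := ⟨hq⟩), Units.val_one]

include h2 hx hp hinj hprod hP in
/-- **The square criterion in coordinates** (Stevenhagen's linear algebra): for `e ∈ 𝔽₂^t`,
`∏ⱼ [𝔭ⱼ]^{eⱼ}` is a square in `Cl_K` iff for every odd `pᵢ`
`Σⱼ Mᵢⱼ eⱼ = 0` in `𝔽₂`, where `Mᵢⱼ = [(pⱼ/pᵢ) = -1]` for `j ≠ i` and `Mᵢᵢ = [((n/pᵢ)/pᵢ) = -1]`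
(the values `ψ_{pᵢ}([𝔭ⱼ])`). [cite: Stevenhagen1995RedeiMatrices, §2 Thm. 1 (proof)] -/
theorem isSquare_prod_pow_iff (e : Fin t → ZMod 2) :
    IsSquare (∏ j, ClassGroup.mk0 ⟨P j, mem_nonZeroDivisors_of_sq_eq_span h2 (hp j) (hP j)⟩ ^ (e j).val) ↔
      ∀ i, p i ≠ 2 →
        ∑ j, (if (if j = i then jacobiSym ((n / p i : ℕ) : ℤ) (p i) else jacobiSym (p j) (p i)) = -1
          then (1 : ZMod 2) else 0) * e j = 0 := by
  classical
  obtain ⟨hn, hn0⟩ := squarefree_and_pos_of_prod_eq hp hinj hprod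
  rw [isSquare_iff_forall_genusChar_eq_one h2 hx hp hinj hprod]
  refine forall_congr' fun i => ⟨fun h hi2 => ?_, fun h hi2 => ?_⟩
  all_goals
    haveI : Fact (p i).Prime := ⟨hp i⟩
    set s : Fin t → ℤ := fun j =>
      if j = i then jacobiSym ((n / p i : ℕ) : ℤ) (p i) else jacobiSym (p j) (p i) with hsdef
    -- the signs `s j = ψ_{pᵢ}([𝔭ⱼ]) ∈ {±1}`
    have hs : ∀ j, s j = 1 ∨ s j = -1 := fun j => by
      by_cases hj : j = i
      · rw [hsdef]; simp only [hj, if_true]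
        refine jacobiSym.eq_one_or_neg_one ?_
        rw [Int.gcd_natCast_natCast]
        change Nat.Coprime (n / p i) (p i)
        rw [Nat.coprime_comm, Nat.Prime.coprime_iff_not_dvd (hp i)]
        intro hdvd
        have hin : p i ∣ n := by
          rcases dvd_or_of_prod_eq hp hprod i with h' | ⟨h2i, -⟩
          · exact h'
          · exact absurd h2i hi2
        have : p i * p i ∣ n := by
          have := Nat.mul_dvd_mul_left (p i) hdvd
          rwa [Nat.mul_div_cancel' hin] at this
        exact (hp i).ne_one (Nat.isUnit_iff.mp (hn (p i) this))
      · rw [hsdef]; simp only [hj, if_false]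
        refine jacobiSym.eq_one_or_neg_one ?_
        rw [Int.gcd_natCast_natCast]
        change Nat.Coprime (p j) (p i)
        rw [Nat.coprime_primes (hp j) (hp i)]
        exact fun h' => hj (hinj h')
    have hval : ∀ j, ((@genusChar K _ _ (isImaginaryQuadratic h2 hn (coe_sq_eq' hx)) (p i) ⟨hp i⟩ hi2
        (natCast_dvd_discr h2 hx hp hinj hprod i)
        (ClassGroup.mk0 ⟨P j, mem_nonZeroDivisors_of_sq_eq_span h2 (hp j) (hP j)⟩) : ℂˣ) : ℂ) =
          (s j : ℂ) := fun j => by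
      by_cases hj : j = i
      · subst hj
        rw [genusChar_mk0_self_eq_jacobiSym h2 hx hp hinj hprod hP hi2, hsdef]
        simp
      · rw [genusChar_mk0_eq_jacobiSym h2 hx hp hinj hprod hP hi2 (Ne.symm hj), hsdef]
        simp [hj]
    have key : (@genusChar K _ _ (isImaginaryQuadratic h2 hn (coe_sq_eq' hx)) (p i) ⟨hp i⟩ hi2
        (natCast_dvd_discr h2 hx hp hinj hprod i)
        (∏ j, ClassGroup.mk0 ⟨P j, mem_nonZeroDivisors_of_sq_eq_span h2 (hp j) (hP j)⟩ ^ (e j).val) = 1) ↔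
        ∏ j, s j ^ (e j).val = 1 := by
      rw [← Units.val_eq_one, map_prod, Units.coe_prod]
      simp_rw [map_pow, Units.val_pow_eq_pow_val, hval, ← Int.cast_pow, ← Int.cast_prod]
      exact Int.cast_eq_one
  · exact (prod_pow_eq_one_iff hs e).mp (key.mp (h hi2))
  · exact key.mpr ((prod_pow_eq_one_iff hs e).mpr (h hi2))

end Setup

end Literature.NumberTheory.QuadraticFields.RedeiReichardt

end
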